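import Summits.BirchSwinnertonDyer.BirchSwinnertonDyer.Theorems.ThetaPartnerAtTwoSignedKatoUpToAtTwoKatoConstantRational
import HarnessLib

/-!
# Route `ThetaPartnerAtTwo` (TP2), crux K3 `SignedKatoDivisibilityUpToAtTwo` (stmt-BirchSwinnertonDyer-20308 / K3P′ 25631), line
# `colemanrat` v13, assembly brick B4c — Kato's value law (C5) at the TRIVIAL character of every `p`-power level, as a rational
# number inside the cyclotomic field: `Σ_b σ_b(x_{k,∅}) = q · P_p(p⁻¹) · [0]⁺_f · R⁻_𝟙`

Width seat `bsd-wall-tp2-p2x-w4` g0 (cell `bsd-wall`), brick B4c of the lead's memo `Cruxes/SignedKatoDivisibilityUpToAtTwo/G7-ASSEMBLY-v1.md` §0.6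
(base cases `n = 0, 1` of (ERL_χ), exp* side). HONEST FRAMING: theorems only (no definition, no named fact, no instance, no `sorry`); every
statement is CONDITIONAL on a `ZetaBody` witness (the conclusion of the cite-only fact `Kato2004.exists_eulerSystem_expStar_values`); closes no
item; K3 / K3P′ are NOT settled and BSD is NOT proved by any of this.

## What

At a `p`-power level `m = p^k` (`k ≥ 1`) with a `p`-power auxiliary modulus `A = p^e`, the even clause of (C5) at the trivial character reads
`Σ_{b∈(ℤ/m)ˣ} ι(σ_b x_{k,∅}) = κ · L_{(p)}(f,1)/Ω⁺_f · R⁻_𝟙`, where the `{p}`-depleted value is `L_{(p)}(f,1) = P_p(p⁻¹)·L(f,1)`,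
`P_p(p⁻¹) = 1 − a_p/p + 𝟙_N(p)/p = eulerFactorAtOne W N p`, `L(f,1) = [0]⁺_f·Ω⁺_f` and `R⁻_𝟙 = ratCuspFactor f true c d a A d′` (the four
minus symbols; `𝟙(c) = 𝟙(d) = 1` because `p ∤ cd`). With `κ = q ∈ ℚ` (brick B3) everything is rational, so inside `F = CyclotomicField m ℚ`:
`Σ_b σ_b(x_{k,∅}) = q · P_p(p⁻¹) · [0]⁺ · R⁻_𝟙` (pull-back along the injective `ι`). On the habitat (`p = 2`, `a₂ = 0`, `2 ∤ N`):
`P_2(2⁻¹) = 3/2` (memo §0.6: `L_{(2)}(f,1) = (3/2)L(f,1)`).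

* §1 `exists_isDepletedTwistedL_one_eq` (any modulus `m`): the continuation `∏_{ℓ∣mM} Euler_ℓ(s)·L(W,s)` of the `(M)`-depleted trivial twist,
  value at `1` displayed (generalises `KatoConst.exists_isDepletedTwistedL_trivial_one_eq`, which is the case `m = 1`).
* §2 `eulerFactors_prime_pow_eq` (`∏_{ℓ ∣ p^j} Euler_ℓ(1) = eulerFactorAtOne W N p`), `eulerFactorAtOne_two_eq` (`= 3/2` when `a₂ = 0`, `2 ∤ N`),
  `cuspFactor_inv_one_eq_ratCuspFactor` (`𝟙⁻¹(c) = 𝟙⁻¹(d) = 1` for `p ∤ cd`).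
* §3 **`sum_sigma_eq_of_zetaBody`**: `Σ_b σ_b(x_{k,∅}) = algebraMap ℚ F (q · eulerFactorAtOne W N p · ratPlusSymbol f 0 · ratCuspFactor f true c d a A d′)`.

References: [Kato2004Asterisque] Thm. 6.6 (1) (p. 163), Thm. 9.7 (p. 189), §6.2 (p. 161), Ex. 13.3 (p. 225), Lemma 13.10 (1) (p. 230);
[MazurTateTeitelbaum1986Invent] §I.8 (8.6).
-/

set_option autoImplicit false
-- the Theorems namespace of this sub repeats the summit name by design (D-0017 nested layout)
set_option linter.dupNamespace false

noncomputable section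

open scoped BigOperators NumberField TensorProduct MatrixGroups

open CongruenceSubgroup Complex WeierstrassCurve IsDedekindDomain
  Literature.NumberTheory.GaloisRepresentations
  Literature.NumberTheory.EllipticCurves Literature.NumberTheory.EllipticCurves.ModularForms
  Literature.NumberTheory.EllipticCurves.Kato2004 Literature.NumberTheory.EllipticCurves.Kato2004.EulerSystemValues

namespace Summit.BirchSwinnertonDyer.BirchSwinnertonDyer.Theorems.SignedKatoOffTwo.KatoValue

variable {W : WeierstrassCurve ℚ} [W.IsElliptic] {N : ℕ} [NeZero N] {f : CuspForm (Gamma0 N) 2}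

/-! ## §1 The depleted trivial twist at any modulus, continued with its value at `1` displayed -/

omit [W.IsElliptic] in
/-- **The `(M)`-depleted trivial twist modulo `m`, continued with a known value at `1`** (any `m, M ≥ 1`): `L(s) := ∏_{ℓ ∣ mM}(1 − a_ℓ ℓ^{−s} +
𝟙_N(ℓ) ℓ·ℓ^{−2s})·L(W,s)` satisfies `IsDepletedTwistedL f m M 𝟙 L` (`changeLevel 𝟙 = 𝟙`, `twistedLSeries_one_eq`), so
`L(1) = ∏_{ℓ∣mM} Euler_ℓ(1)·L(W,1)`. [cite: Kato2004Asterisque, §6.2 (p. 161)] -/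
theorem exists_isDepletedTwistedL_one_eq (hf : IsNewformOf W f) (m : ℕ) [NeZero m] (M : ℕ) [NeZero M] :
    ∃ L : ℂ → ℂ, IsDepletedTwistedL f m M (1 : DirichletCharacter ℂ m) L ∧
      L 1 = (∏ ℓ ∈ (m * M).primeFactors, (1 - cuspCoeff f ℓ * (ℓ : ℂ) ^ (-(1 : ℂ)) +
        (if ℓ ∣ N then 0 else (ℓ : ℂ)) * ((ℓ : ℂ) ^ (-(1 : ℂ))) ^ 2)) * W.entireLFunction 1 := by
  haveI : NeZero (m * M) := ⟨mul_ne_zero (NeZero.ne m) (NeZero.ne M)⟩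
  have hE : W.HasEntireLFunction := hf.hasEntireLFunction
  set P : ℂ → ℂ := fun s ↦ ∏ ℓ ∈ (m * M).primeFactors, (1 - cuspCoeff f ℓ * (ℓ : ℂ) ^ (-s) +
    (if ℓ ∣ N then 0 else (ℓ : ℂ)) * ((ℓ : ℂ) ^ (-s)) ^ 2) with hP
  have ht : ∀ ℓ ∈ (m * M).primeFactors, Differentiable ℂ fun s : ℂ => (ℓ : ℂ) ^ (-s) := fun ℓ hℓ =>
    differentiable_neg.const_cpow (Or.inl (Nat.cast_ne_zero.mpr (Nat.prime_of_mem_primeFactors hℓ).ne_zero))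
  have hPd : Differentiable ℂ P := by
    rw [hP]
    exact Differentiable.fun_finsetProd (𝕜 := ℂ) (u := (m * M).primeFactors)
      (f := fun (ℓ : ℕ) (s : ℂ) => 1 - cuspCoeff f ℓ * (ℓ : ℂ) ^ (-s) +
        (if ℓ ∣ N then 0 else (ℓ : ℂ)) * ((ℓ : ℂ) ^ (-s)) ^ 2)
      fun ℓ hℓ => ((differentiable_const _).sub ((differentiable_const _).mul (ht ℓ hℓ))).add
        ((differentiable_const _).mul ((ht ℓ hℓ).pow 2))
  refine ⟨fun s ↦ P s * W.entireLFunction s, ⟨hPd.mul (W.differentiable_entireLFunction hE), fun s hs ↦ ?_⟩, rfl⟩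
  have hs' : (3 / 2 : ℝ) < s.re := by
    have : (2 : ℝ) < s.re := hs
    linarith
  change P s * W.entireLFunction s = _
  rw [DirichletCharacter.changeLevel_one, twistedLSeries_one_eq hf.1 (m * M) hs, hf.cuspFormLSeries_eq,
    W.entireLFunction_eq_LSeries hE hs']

/-! ## §2 Bookkeeping at a `p`-power level -/

omit [W.IsElliptic] in
/-- **At a `p`-power modulus only the Euler factor at `p` is removed**: `∏_{ℓ ∣ p^j} Euler_ℓ(1) = P_p(p⁻¹) = eulerFactorAtOne W N p` for `j ≥ 1`
(the newform of `W` has `a_p(f) = a_p(W)`). [cite: Kato2004Asterisque, §6.2 (p. 161), Ex. 13.3 (p. 225)] -/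
theorem eulerFactors_prime_pow_eq (hf : IsNewformOf W f) (p : ℕ) [Fact p.Prime] {j : ℕ} (hj : j ≠ 0) :
    (∏ ℓ ∈ (p ^ j).primeFactors, (1 - cuspCoeff f ℓ * (ℓ : ℂ) ^ (-(1 : ℂ)) + (if ℓ ∣ N then 0 else (ℓ : ℂ)) * ((ℓ : ℂ) ^ (-(1 : ℂ))) ^ 2)) =
      ((eulerFactorAtOne W N p : ℚ) : ℂ) := by
  have hp : p.Prime := Fact.out
  have hp0 : (p : ℂ) ≠ 0 := Nat.cast_ne_zero.mpr hp.ne_zero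
  rw [Nat.primeFactors_prime_pow hj hp, Finset.prod_singleton, hf.2 p, cpow_neg_one]
  unfold eulerFactorAtOne
  split_ifs
  · push_cast
    field_simp
    ring
  · push_cast
    field_simp

omit [W.IsElliptic] [NeZero N] in
/-- **On the habitat `P_2(2⁻¹) = 3/2`**: `a₂(W) = 0` and `2 ∤ N` give `1 − 0/2 + 1/2 = 3/2` (memo §0.6: `L_{(2)}(f,1) = (3/2)·L(f,1)`).
[cite: Kato2004Asterisque, §6.2 (p. 161)] -/
theorem eulerFactorAtOne_two_eq (ha : W.LFunction 2 = 0) (hN : ¬ 2 ∣ N) : eulerFactorAtOne W N 2 = 3 / 2 := by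
  rw [eulerFactorAtOne, ha, if_neg hN]
  norm_num

omit [W.IsElliptic] [NeZero N] in
/-- **At the trivial character the complex four-cusp factor is the rational one** when `c, d` are units modulo `m` (`𝟙⁻¹(c) = 𝟙⁻¹(d) =
𝟙⁻¹(cd) = 1`): `cuspFactor f true 𝟙⁻¹ c d a A d′ = ratCuspFactor f true c d a A d′`. [cite: Kato2004Asterisque, Thm. 6.6 (1) (p. 163)] -/
theorem cuspFactor_inv_one_eq_ratCuspFactor {m : ℕ} (c d a : ℤ) (A : ℕ) (d' : ℤ)
    (hc : IsUnit ((c : ℤ) : ZMod m)) (hd : IsUnit ((d : ℤ) : ZMod m)) :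
    cuspFactor f true (fun n ↦ (1 : DirichletCharacter ℂ m)⁻¹ (n : ZMod m)) c d a A d' = (ratCuspFactor f true c d a A d' : ℂ) := by
  rw [← cuspFactor_one_eq_ratCuspFactor]
  have hcd : IsUnit (((c * d : ℤ) : ZMod m)) := by rw [Int.cast_mul]; exact hc.mul hd
  simp only [cuspFactor, inv_one, MulChar.one_apply hc, MulChar.one_apply hd, MulChar.one_apply hcd]

/-- Units from Kato's guard: `(cd, m·A) = 1 ⇒ c` and `d` are units modulo `m`. [folklore] -/
theorem isUnit_intCast_of_gcd_mul_eq_one {m A : ℕ} {c d : ℤ} (hcd : Int.gcd (c * d) ((m : ℤ) * A) = 1) :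
    IsUnit ((c : ℤ) : ZMod m) ∧ IsUnit ((d : ℤ) : ZMod m) := by
  have h : IsCoprime (c * d) ((m : ℤ) * A) := Int.isCoprime_iff_gcd_eq_one.mpr hcd
  have hc : IsCoprime c (m : ℤ) := (h.of_mul_left_left).of_mul_right_left
  have hd : IsCoprime d (m : ℤ) := (h.of_mul_left_right).of_mul_right_left
  exact ⟨isUnit_iff_exists_inv.mpr ⟨_, ZMod.coe_int_mul_inv_eq_one hc⟩,
    isUnit_iff_exists_inv.mpr ⟨_, ZMod.coe_int_mul_inv_eq_one hd⟩⟩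

/-! ## §3 The trivial-character values inside the cyclotomic field -/

/-- **Kato's trivial-character value at a `p`-power level, in `F = ℚ(ζ_{p^k})`.** Let `f` be the newform of `W`, `p` a prime,
`ZetaBody W p f ι κ Λ c d a A z x` a Kato witness with `κ = q ∈ ℚ`, `A = p^e`, `k ≥ 1`, guards `(cd, p^k·A) = 1`, `dd′ ≡ 1 (A)`. Then
`Σ_{b ∈ (ℤ/p^k)ˣ} σ_b(x_{k,∅}) = q · P_p(p⁻¹) · [0]⁺_f · R⁻_𝟙` in `F` (as the image of a rational number), `P_p(p⁻¹) = eulerFactorAtOne W N p`,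
`R⁻_𝟙 = ratCuspFactor f true c d a A d′`. Proof: (C5) at `χ = 𝟙` (even) with the continuation `Euler_p(s)·L(W,s)` of §1
(`ι(Σ_b σ_b x) = κ·Euler_p(1)·L(W,1)/Ω⁺·R⁻`, `L(W,1) = [0]⁺Ω⁺` by `IsNewformOf.entireLFunction_one_eq`), then injectivity of `ι`.
CONDITIONAL on the `ZetaBody` witness; any `ι`. [cite: Kato2004Asterisque, Thm. 6.6 (1) (p. 163), Thm. 9.7 (p. 189), §6.2 (p. 161)]
[cite: MazurTateTeitelbaum1986Invent, §I.8 (8.6)] -/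
theorem sum_sigma_eq_of_zetaBody (hf : IsNewformOf W f) (p : ℕ) [Fact p.Prime]
    [ContinuousSMul ℤ_[p] (W.tateModule p)] [Module.Free ℤ_[p] (W.tateModule p)] [Module.Finite ℤ_[p] (W.tateModule p)]
    {ι : (m : ℕ) → (CyclotomicField m ℚ →+* ℂ)} {κ : ℝ}
    {Λ : ∀ (k : ℕ) (r : Finset (HeightOneSpectrum (𝓞 ℚ))),
      H1 (tateRep W p) (cycSubgroup p k r) →ₗ[ℤ_[p]] ℚ_[p] ⊗[ℚ] CyclotomicField (cycLevel p k r) ℚ}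
    {c d a : ℤ} {A : ℕ}
    {z : ∀ (k : ℕ) (r : (cyclotomicLevelsRat p (badPlaces c d A N)).Ideals),
      H1 (tateRep W p) ((cyclotomicLevelsRat p (badPlaces c d A N)).level k r.1)}
    {x : ∀ (k : ℕ) (r : (cyclotomicLevelsRat p (badPlaces c d A N)).Ideals),
      CyclotomicField (cycLevel p k r.1) ℚ}
    (hbody : ZetaBody W p f ι κ Λ c d a A z x) {q : ℚ} (hκ : κ = q)
    {k e : ℕ} (hk : 1 ≤ k) (hA : A = p ^ e) (d' : ℤ)
    (hcd : Int.gcd (c * d) (cycLevel p k (∅ : Finset (HeightOneSpectrum (𝓞 ℚ))) * A) = 1)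
    (hdd' : d * d' ≡ 1 [ZMOD (A : ℤ)]) :
    ∑ b : (ZMod (cycLevel p k (∅ : Finset (HeightOneSpectrum (𝓞 ℚ)))))ˣ,
        sigma (cycLevel p k (∅ : Finset (HeightOneSpectrum (𝓞 ℚ)))) b (x k (cyclotomicLevelsRat p (badPlaces c d A N)).idealOne) =
      algebraMap ℚ (CyclotomicField (cycLevel p k (∅ : Finset (HeightOneSpectrum (𝓞 ℚ)))) ℚ)
        (q * eulerFactorAtOne W N p * ratPlusSymbol f 0 * ratCuspFactor f true c d a A d') := by
  have hp : p.Prime := Fact.out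
  have hm : cycLevel p k (∅ : Finset (HeightOneSpectrum (𝓞 ℚ))) = p ^ k := by
    rw [cycLevel, Finset.prod_empty, mul_one]
  haveI : NeZero A := ⟨by rw [hA]; exact pow_ne_zero _ hp.ne_zero⟩
  haveI : NeZero (p * A) := ⟨mul_ne_zero hp.ne_zero (NeZero.ne A)⟩
  -- the continuation of §1 and its value
  obtain ⟨L, hL, hL1eq⟩ := exists_isDepletedTwistedL_one_eq hf (cycLevel p k (∅ : Finset (HeightOneSpectrum (𝓞 ℚ)))) (p * A)
  have hprod : cycLevel p k (∅ : Finset (HeightOneSpectrum (𝓞 ℚ))) * (p * A) = p ^ (k + 1 + e) := by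
    rw [hm, hA]; ring
  rw [hprod, eulerFactors_prime_pow_eq hf p (by omega : k + 1 + e ≠ 0)] at hL1eq
  -- units modulo `m` from the guard
  obtain ⟨hc, hd⟩ := isUnit_intCast_of_gcd_mul_eq_one (m := cycLevel p k (∅ : Finset (HeightOneSpectrum (𝓞 ℚ)))) (A := A) hcd
  -- Kato (C5) at the trivial character
  obtain ⟨-, -, -, -, -, hC5⟩ := hbody
  have hK : charSum (cycLevel p k (∅ : Finset (HeightOneSpectrum (𝓞 ℚ)))) (ι (cycLevel p k (∅ : Finset (HeightOneSpectrum (𝓞 ℚ)))))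
      1 (x k (cyclotomicLevelsRat p (badPlaces c d A N)).idealOne) =
      κ * (L 1 / (plusPeriod f : ℂ)) *
        cuspFactor f true (fun n ↦ (1 : DirichletCharacter ℂ _)⁻¹ (n : ZMod (cycLevel p k (∅ : Finset (HeightOneSpectrum (𝓞 ℚ))))))
          c d a A d' :=
    (hC5 k (cyclotomicLevelsRat p (badPlaces c d A N)).idealOne d' 1 L hcd hdd' hL).1 (MulChar.one_apply (isUnit_one.neg))
  -- `L(W,1) = [0]⁺ Ω⁺`, `Ω⁺ ≠ 0`
  have hΩ : (plusPeriod f : ℂ) ≠ 0 := by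
    exact_mod_cast (IsNewform0.plusPeriod_pos_holds hf.1 hf.coeffField_eq_bot).ne'
  have hLval : W.entireLFunction 1 = ((ratPlusSymbol f 0 : ℚ) : ℂ) * (plusPeriod f : ℂ) := by
    rw [hf.entireLFunction_one_eq]; push_cast; ring
  -- the character sum is `ι (Σ_b σ_b x)`
  have hcs : charSum (cycLevel p k (∅ : Finset (HeightOneSpectrum (𝓞 ℚ)))) (ι (cycLevel p k (∅ : Finset (HeightOneSpectrum (𝓞 ℚ)))))
      1 (x k (cyclotomicLevelsRat p (badPlaces c d A N)).idealOne) =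
      ι (cycLevel p k (∅ : Finset (HeightOneSpectrum (𝓞 ℚ)))) (∑ b : (ZMod (cycLevel p k (∅ : Finset (HeightOneSpectrum (𝓞 ℚ)))))ˣ,
        sigma (cycLevel p k (∅ : Finset (HeightOneSpectrum (𝓞 ℚ)))) b (x k (cyclotomicLevelsRat p (badPlaces c d A N)).idealOne)) := by
    rw [charSum, map_sum]
    refine Finset.sum_congr rfl fun b _ ↦ ?_
    rw [MulChar.one_apply (Units.isUnit b), one_mul]
  apply (ι (cycLevel p k (∅ : Finset (HeightOneSpectrum (𝓞 ℚ))))).injective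
  rw [← hcs, hK, hL1eq, hLval, cuspFactor_inv_one_eq_ratCuspFactor c d a A d' hc hd, hκ, RingHom.map_rat_algebraMap,
    eq_ratCast, Complex.ofReal_ratCast]
  push_cast
  field_simp

end Summit.BirchSwinnertonDyer.BirchSwinnertonDyer.Theorems.SignedKatoOffTwo.KatoValue

end
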